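import Summits.Ventures.LatticeQCDFlow.Scaling.TightSectorGapLaw
import Summits.Ventures.LatticeQCDFlow.Scaling.HubAcceptanceLaw
import Summits.Ventures.LatticeQCDFlow.Scaling.DominatedStarRegimeFreeTimeAverages

/-!
HONEST FRAMING: exact (Metropolis-corrected) sampling algorithms for lattice gauge theory; figures
of merit are autocorrelation/cost numbers at stated couplings and volumes; no continuum-physics
claim.

# SectorOfferCeiling — A COLD REPLICA CROSSES A SECTOR NO FASTER THAN THE HUB OFFERS IT THAT SECTOR:
# `Gap ≤ (t·c_k/m)·μ_0(A)/μ_k(A)` FOR EVERY SECTOR-IDLE COLD LEVEL `k` LISTED `c_k` TIMES WITH `A`-PRESERVING ENTRY MAPS; AT A TIGHT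
# SECTOR `Gap ≤ t·c_k·p'/m` — THE LEAST-LISTED LEVEL SETS THE PACE AND THE PACE IS LINEAR IN THE MAP QUALITY:
# `p·ct/(3m) ∧ … ≤ Gap ≤ p'·c_min·t/m`, `t_mix(ε) ≥ (m/(t·c_k·p') − 1)·log(1/(2ε))` (lean-2 GEN-29, ours)

Venture-side (OURS).  Cell `lqcd-flow` (pub-lqcd), unit `pub-lqcd-lean-2-g29`, 2026-08-28.  Chapter O (the floor sees the map quality),
file 3.  Chapter K's replica ceilings (`Scaling/HubProposalLaw`: `Gap ≤ t·deg(k)/(2m·μ_k(A)μ_k(Aᶜ))`; `Scaling/HubAcceptanceLaw`: the same with the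
measured acceptances `Σ_{r∋k}α_r` in place of `deg(k)`) test the scheme against ONE cold replica's sector indicator but bound the squared jump of
the indicator by `1` on every proposal.  Keeping the jump — it is `1` exactly when the swap moves level `k` across `∂A`, i.e. when the hub holds a
configuration on the other side — gives the SECTOR-CROSSING ACCEPTANCE of a hub entry `(0,k)` with an `A`-preserving map `ψ`:
`Σ_x min{π̃(x), π̃(x^{ψ})}·(𝟙_{Aᶜ}(x_0) − 𝟙_{Aᶜ}(x_k))² ≤ 2·μ_0(A)·μ_k(Aᶜ)` (bound the minimum by `π̃(x)` when `x_0 ∈ A`, by `π̃(x^{ψ})` when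
`x_k ∈ A`, and re-index through `ψ`).  Hence, for the chapter-M/N hub list `r ↦ (0, κ_r+1)`:

## What is proved

* §1 **`crossingAcceptance_le`** — the display above for any edge `(i,l)`, `i ≠ l`: `≤ 2·μ_i(A)·μ_l(Aᶜ)`.
* §2 **`sectorOffer_spectralGap_le`** — any `0 ≤ t ≤ 1`, probability vector `w`, reversible kernels, level `k+1` sector-idle
  (`w_{k+1}·Q_{k+1}(A,Aᶜ) = 0`), maps preserving `A`, `μ_{k+1}(A)μ_{k+1}(Aᶜ) > 0`, `c_k = #{r : κ_r = k}`:
  **`Gap ≤ t·c_k·μ_0(A)/(m·μ_{k+1}(A))`**.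
* §3 **`tightSector_spectralGap_le_level`** — tight sector (`μ_j(A) = θ ∈ (0,1)` for `j ≠ 0`, `μ_0(A) ≤ p'θ`): **`Gap ≤ t·c_k·p'/m`** for every cold
  level; **`tightSector_spectralGap_two_sided_level`** — with chapter N's floor (exact hot redraws, one-sided domination `p`, multiplicities `≥ c`):
  **`p·min{ct/(3m), (1−t)w_0/(7K)} ≤ Gap ≤ p'·c_k·t/m`** for EVERY cold level `k` — matched in the listing unit `c/m` up to `3` and linear in the quality
  from both sides.
* §4 **`tightSector_mixingTime_ge_level`** — exact hot redraws, `0 < ε ≤ ½`, `t·c_k·p' < m`: **`t_mix(ε) ≥ (m/(t·c_k·p') − 1)·log(1/(2ε))`**.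

Reading (no numerics implied): the swap budget of the map-assisted hub is paid PER REPLICA and PER UNIT OF MAP QUALITY: a replica listed `c_k` times
out of `m` is offered a transported hot configuration lying in its rare sector at rate `(t·c_k/m)·μ_0(A)`, and its sector census cannot relax faster
than that rate divided by its own sector mass — whatever the hot sampler, the other replicas, the allocation `w` and the regime.  Chapter K's
`t·deg(k)/(2m·μ_k(A)μ_k(Aᶜ))` is recovered and sharpened by the factor `2μ_0(A)μ_k(Aᶜ)` (`≤ 2p'θ(1−θ)` at a tight sector, where K's bound degrades as
`θ → 0` and this one does not).  NOT CLAIMED: the refresh budget per replica (it is global, O1); the `log K`; anything measured.  Literature grade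
(cell rule): OWN RESULT (test-function ceiling with the crossing acceptance); nothing cited as a fact; no new bib keys.
-/

noncomputable section

open Finset Function
open Literature.Probability.MarkovChains

namespace Summit.Ventures.LatticeQCDFlow.Scaling

variable {S : Type*} [Fintype S] [DecidableEq S] {K m : ℕ} {μ : Fin (K + 1) → S → ℝ} {M : Fin (K + 1) → S → S → ℝ}
  {w : Fin (K + 1) → ℝ} {t p : ℝ}

/-! ## §1 The sector-crossing acceptance of an edge with a sector-preserving map -/

/-- **THE SECTOR-CROSSING ACCEPTANCE:** for an edge `(i,l)`, `i ≠ l`, a map `ψ` preserving `A`, positive unit-mass laws: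
`Σ_x min{π̃(x), π̃(edgeFlowSwap ψ i l x)}·(𝟙_{Aᶜ}(x_i) − 𝟙_{Aᶜ}(x_l))² ≤ 2·μ_i(A)·μ_l(Aᶜ)`. [ours] -/
theorem crossingAcceptance_le (hμ : ∀ k u, 0 < μ k u) (hμ1 : ∀ k, ∑ u, μ k u = 1) {ψ : Equiv.Perm S} {A : Finset S}
    (hψA : ∀ u, ψ u ∈ A ↔ u ∈ A) {i l : Fin (K + 1)} (hil : i ≠ l) :
    ∑ x : Fin (K + 1) → S, min (tensorFun μ x) (tensorFun μ (edgeFlowSwap ψ i l x))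
        * ((if x i ∈ A then (0 : ℝ) else 1) - (if x l ∈ A then (0 : ℝ) else 1)) ^ 2
      ≤ 2 * ((∑ u ∈ A, μ i u) * ∑ u ∈ Aᶜ, μ l u) := by
  -- the two-variable majorant
  set g : S → S → ℝ := fun u v =>
    (if u ∈ A then (if v ∈ A then (0 : ℝ) else 1) else 0)
      + (if u ∈ A then (0 : ℝ) else (if v ∈ A then μ i (ψ.symm v) * μ l (ψ u) / (μ i u * μ l v) else 0)) with hg
  have hψAs : ∀ v, ψ.symm v ∈ A ↔ v ∈ A := fun v => by rw [← hψA (ψ.symm v), Equiv.apply_symm_apply]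
  have hpt : ∀ x : Fin (K + 1) → S, min (tensorFun μ x) (tensorFun μ (edgeFlowSwap ψ i l x))
        * ((if x i ∈ A then (0 : ℝ) else 1) - (if x l ∈ A then (0 : ℝ) else 1)) ^ 2
      ≤ tensorFun μ x * g (x i) (x l) := by
    intro x
    have hπ := tensorFun_pos hμ x
    have hpos : 0 < μ i (x i) * μ l (x l) := mul_pos (hμ _ _) (hμ _ _)
    have hsw : tensorFun μ (edgeFlowSwap ψ i l x)
        = tensorFun μ x * (μ i (ψ.symm (x l)) * μ l (ψ (x i)) / (μ i (x i) * μ l (x l))) := by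
      rw [mul_div_assoc', eq_div_iff hpos.ne', tensorFun_edgeFlowSwap_mul μ ψ hil]
    by_cases hi : x i ∈ A
    · by_cases hl : x l ∈ A
      · rw [if_pos hi, if_pos hl, sub_self]
        have : g (x i) (x l) = 0 := by rw [hg]; simp only [hi, hl, if_true]; ring
        rw [this]; simp
      · rw [if_pos hi, if_neg hl]
        have : g (x i) (x l) = 1 := by rw [hg]; simp only [hi, hl, if_true, if_false]; ring
        rw [this, mul_one]
        calc min (tensorFun μ x) (tensorFun μ (edgeFlowSwap ψ i l x)) * ((0 : ℝ) - 1) ^ 2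
            = min (tensorFun μ x) (tensorFun μ (edgeFlowSwap ψ i l x)) := by norm_num
          _ ≤ tensorFun μ x := min_le_left _ _
    · by_cases hl : x l ∈ A
      · rw [if_neg hi, if_pos hl]
        have : g (x i) (x l) = μ i (ψ.symm (x l)) * μ l (ψ (x i)) / (μ i (x i) * μ l (x l)) := by
          rw [hg]; simp only [hi, hl, if_true, if_false]; ring
        rw [this, ← hsw]
        calc min (tensorFun μ x) (tensorFun μ (edgeFlowSwap ψ i l x)) * ((1 : ℝ) - 0) ^ 2
            = min (tensorFun μ x) (tensorFun μ (edgeFlowSwap ψ i l x)) := by norm_num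
          _ ≤ tensorFun μ (edgeFlowSwap ψ i l x) := min_le_right _ _
      · rw [if_neg hi, if_neg hl, sub_self]
        have : g (x i) (x l) = 0 := by rw [hg]; simp only [hi, hl, if_false]; ring
        rw [this]; simp
  refine (sum_le_sum fun x _ => hpt x).trans ?_
  rw [sum_tensorFun_mul_two_fun hμ1 hil g]
  -- evaluate the two-variable sum: the two cases each give `μ_i(A)·μ_l(Aᶜ)`
  have hsplit : ∀ u v, μ i u * μ l v * g u v
      = (if u ∈ A then μ i u else 0) * (if v ∈ A then 0 else μ l v)
        + (if u ∈ A then 0 else μ l (ψ u)) * (if v ∈ A then μ i (ψ.symm v) else 0) := by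
    intro u v
    have hpos : μ i u * μ l v ≠ 0 := (mul_pos (hμ _ _) (hμ _ _)).ne'
    rw [hg]
    by_cases hu : u ∈ A
    · by_cases hv : v ∈ A
      · simp only [hu, hv, if_true]; ring
      · simp only [hu, hv, if_true, if_false]; ring
    · by_cases hv : v ∈ A
      · simp only [hu, hv, if_true, if_false, zero_add, zero_mul]
        rw [mul_div_assoc', div_eq_iff hpos]
        ring
      · simp only [hu, hv, if_false]; ring
  simp_rw [hsplit, sum_add_distrib, ← Finset.sum_mul_sum]
  -- first product: `μ_i(A)·μ_l(Aᶜ)`; second: `μ_l(ψ Aᶜ)·μ_i(ψ⁻¹A) = μ_l(Aᶜ)·μ_i(A)`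
  have h1 : ∑ u, (if u ∈ A then μ i u else 0) = ∑ u ∈ A, μ i u := by rw [← sum_filter]; congr 1; ext; simp
  have h2 : ∑ v, (if v ∈ A then (0 : ℝ) else μ l v) = ∑ v ∈ Aᶜ, μ l v := by
    rw [← Finset.sum_add_sum_compl A]
    rw [Finset.sum_eq_zero (fun v hv => by rw [if_pos hv]), zero_add]
    exact sum_congr rfl fun v hv => by rw [if_neg (Finset.mem_compl.mp hv)]
  have h3 : ∑ u, (if u ∈ A then (0 : ℝ) else μ l (ψ u)) = ∑ v ∈ Aᶜ, μ l v := by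
    rw [← Finset.sum_add_sum_compl A]
    rw [Finset.sum_eq_zero (fun u hu => by rw [if_pos hu]), zero_add]
    rw [show ∑ u ∈ Aᶜ, (if u ∈ A then (0 : ℝ) else μ l (ψ u)) = ∑ u ∈ Aᶜ, μ l (ψ u) from
      sum_congr rfl fun u hu => by rw [if_neg (Finset.mem_compl.mp hu)]]
    exact Finset.sum_nbij' (fun u => ψ u) (fun u => ψ.symm u)
      (fun u hu => Finset.mem_compl.mpr fun h => (Finset.mem_compl.mp hu) ((hψA u).1 h))
      (fun u hu => Finset.mem_compl.mpr fun h => (Finset.mem_compl.mp hu) ((hψAs u).1 h))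
      (fun u _ => Equiv.symm_apply_apply _ _) (fun u _ => Equiv.apply_symm_apply _ _) (fun u _ => rfl)
  have h4 : ∑ v, (if v ∈ A then μ i (ψ.symm v) else 0) = ∑ u ∈ A, μ i u := by
    rw [← sum_filter, show univ.filter (fun v => v ∈ A) = A by ext; simp]
    exact Finset.sum_nbij' (fun v => ψ.symm v) (fun u => ψ u) (fun v hv => (hψAs v).2 hv) (fun u hu => (hψA u).2 hu)
      (fun v _ => Equiv.apply_symm_apply _ _) (fun u _ => Equiv.symm_apply_apply _ _) (fun v _ => rfl)
  rw [h1, h2, h3, h4]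
  have h0 : 0 ≤ (∑ u ∈ A, μ i u) * ∑ v ∈ Aᶜ, μ l v :=
    mul_nonneg (sum_nonneg fun u _ => (hμ _ _).le) (sum_nonneg fun u _ => (hμ _ _).le)
  nlinarith [h0]

/-! ## §2 The offer ceiling of one cold replica -/

section Star
variable (κ : Fin m → Fin K) (φ : Fin m → Equiv.Perm S)

/-- **THE OFFER CEILING: `Gap ≤ t·c_k·μ_0(A)/(m·μ_{k+1}(A))`** for the hub list `r ↦ (0, κ_r+1)` with `A`-preserving entry maps, any
`0 ≤ t ≤ 1`, any probability vector `w`, `μ_j`-reversible kernels, level `k+1` sector-idle, `μ_{k+1}(A)μ_{k+1}(Aᶜ) > 0`, `m ≥ 1`, `|S| ≥ 2`;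
`c_k = #{r : κ_r = k}`. [ours] -/
theorem sectorOffer_spectralGap_le [Nontrivial S] (hm : 1 ≤ m) (hμ : ∀ k x, 0 < μ k x) (hμ1 : ∀ k, ∑ u, μ k u = 1)
    (hM : ∀ k, IsRowStochastic (M k)) (hMrev : ∀ k, DetailedBalance (μ k) (M k)) (hw0 : ∀ k, 0 ≤ w k) (hw1 : ∑ k, w k = 1)
    (ht0 : 0 ≤ t) (ht1 : t ≤ 1) {A : Finset S} (hφA : ∀ r u, φ r u ∈ A ↔ u ∈ A) (k : Fin K)
    (hAk : 0 < (∑ u ∈ A, μ k.succ u) * ∑ u ∈ Aᶜ, μ k.succ u)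
    (hidle : w k.succ * edgeMeasure (μ k.succ) (M k.succ) A Aᶜ = 0) :
    spectralGap (tensorFun μ) (fun y z : Fin (K + 1) → S =>
        t * ptGraphSwap μ (fun r : Fin m => (((0 : Fin (K + 1)), (κ r).succ) : Fin (K + 1) × Fin (K + 1))) φ y z
          + (1 - t) * prodKernel w M y z)
      ≤ t * ((univ.filter (fun r : Fin m => κ r = k)).card : ℝ) * (∑ u ∈ A, μ 0 u) / (m * ∑ u ∈ A, μ k.succ u) := by
  have hmpos : (0 : ℝ) < m := Nat.cast_pos.mpr (by omega)
  set e : Fin m → Fin (K + 1) × Fin (K + 1) := fun r => (((0 : Fin (K + 1)), (κ r).succ) : Fin (K + 1) × Fin (K + 1))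
    with he_def
  have he : ∀ r, (e r).1 ≠ (e r).2 := fun r => (Fin.succ_ne_zero (κ r)).symm
  set a : Fin (K + 1) → ℝ := fun i => if i = k.succ then (1 : ℝ) else 0 with ha
  set G : (Fin (K + 1) → S) → ℝ := fun x => ∑ i, a i * bottleneckTestFun (μ i) A (x i) with hG
  have hQ := ptGraphSwap_isRowStochastic (e := e) (φ := φ) hμ
  have hQrev := ptGraphSwap_detailedBalance (e := e) (φ := φ) hμ
  have hP := weightedScheme_isRowStochastic (t := t) (w := w) hQ hM hw0 hw1 ht0 ht1
  have hDB := weightedScheme_detailedBalance (w := w) hQrev hMrev t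
  have hden : ∑ i, a i ^ 2 * ((∑ u ∈ A, μ i u) * ∑ u ∈ Aᶜ, μ i u) = (∑ u ∈ A, μ k.succ u) * ∑ u ∈ Aᶜ, μ k.succ u := by
    simp_rw [ha, ite_pow, one_pow, zero_pow two_ne_zero, ite_mul, one_mul, zero_mul]
    rw [Finset.sum_ite_eq' univ k.succ, if_pos (mem_univ _)]
  have hupd : ∑ i, w i * (a i ^ 2 * edgeMeasure (μ i) (M i) A Aᶜ) = 0 := by
    simp_rw [ha, ite_pow, one_pow, zero_pow two_ne_zero, ite_mul, one_mul, zero_mul, mul_ite, mul_zero]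
    rw [Finset.sum_ite_eq' univ k.succ, if_pos (mem_univ _)]; exact hidle
  have hray := LevinPeres2017_lemma_13_7_rayleigh (tensorFun_pos hμ) (sum_tensorFun_eq_one μ hμ1) hP hDB
    (ptBare_mean_profileCount (μ := μ) hμ1 a A)
  rw [ptBare_piInner_profileCount hμ1 a A, weightedScheme_dirichletForm (Q := ptGraphSwap μ e φ) (w := w) (M := M),
    prodKernel_dirichletForm_profileCount hμ1 hM hMrev w a A, hden, hupd, mul_zero, add_zero] at hray
  have hsw := ptGraph_dirichletForm_swap_le_acc (e := e) (φ := φ) hμ he G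
  have hak : ∀ i, a i = if i = k.succ then (1 : ℝ) else 0 := fun i => by rw [ha]
  -- entry by entry: the crossing acceptance at level `k+1`, nothing elsewhere
  have hentry : ∀ r : Fin m, ∑ x : Fin (K + 1) → S,
        min (tensorFun μ x) (tensorFun μ (edgeFlowSwap (φ r) (e r).1 (e r).2 x))
          * (G x - G (edgeFlowSwap (φ r) (e r).1 (e r).2 x)) ^ 2
      ≤ if κ r = k then 2 * ((∑ u ∈ A, μ 0 u) * ∑ u ∈ Aᶜ, μ k.succ u) else 0 := by
    intro r
    have hsq : ∀ x : Fin (K + 1) → S, (G x - G (edgeFlowSwap (φ r) (e r).1 (e r).2 x)) ^ 2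
        = (a (e r).1 - a (e r).2) ^ 2
          * ((if x (e r).1 ∈ A then (0 : ℝ) else 1) - (if x (e r).2 ∈ A then (0 : ℝ) else 1)) ^ 2 := by
      intro x
      rw [hG]
      simp only
      rw [graphProfileCount_sub_swap hμ1 a (hφA r) (he r) x, mul_pow]
    simp_rw [hsq]
    have h1 : (e r).1 = 0 := rfl
    have h2 : (e r).2 = (κ r).succ := rfl
    have ha1 : a (e r).1 = 0 := by rw [hak, h1, if_neg (Fin.succ_ne_zero k).symm]
    by_cases hr : κ r = k
    · have ha2 : a (e r).2 = 1 := by rw [hak, h2, hr, if_pos rfl]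
      rw [if_pos hr, ha1, ha2]
      have e1 : ∀ x : Fin (K + 1) → S, min (tensorFun μ x) (tensorFun μ (edgeFlowSwap (φ r) (e r).1 (e r).2 x))
          * (((0 : ℝ) - 1) ^ 2 * ((if x (e r).1 ∈ A then (0 : ℝ) else 1) - (if x (e r).2 ∈ A then (0 : ℝ) else 1)) ^ 2)
          = min (tensorFun μ x) (tensorFun μ (edgeFlowSwap (φ r) (e r).1 (e r).2 x))
          * ((if x (e r).1 ∈ A then (0 : ℝ) else 1) - (if x (e r).2 ∈ A then (0 : ℝ) else 1)) ^ 2 := by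
        intro x; ring
      simp_rw [e1]
      have h := crossingAcceptance_le (μ := μ) hμ hμ1 (hφA r) (he r)
      rw [h1, h2, hr] at h
      rw [h1, h2, hr]
      exact h
    · have ha2 : a (e r).2 = 0 := by
        rw [hak, h2, if_neg (fun h => hr (Fin.succ_injective _ h))]
      rw [if_neg hr, ha1, ha2]
      refine Finset.sum_nonpos fun x _ => ?_
      have : ((0 : ℝ) - 0) ^ 2 * ((if x (e r).1 ∈ A then (0 : ℝ) else 1) - (if x (e r).2 ∈ A then (0 : ℝ) else 1)) ^ 2 = 0 := by
        ring
      rw [this, mul_zero]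
  have hsum : ∑ r : Fin m, ∑ x : Fin (K + 1) → S,
        min (tensorFun μ x) (tensorFun μ (edgeFlowSwap (φ r) (e r).1 (e r).2 x))
          * (G x - G (edgeFlowSwap (φ r) (e r).1 (e r).2 x)) ^ 2
      ≤ ((univ.filter (fun r : Fin m => κ r = k)).card : ℝ) * (2 * ((∑ u ∈ A, μ 0 u) * ∑ u ∈ Aᶜ, μ k.succ u)) := by
    refine (sum_le_sum fun r _ => hentry r).trans ?_
    rw [Finset.sum_ite, Finset.sum_const_zero, add_zero, sum_const, nsmul_eq_mul]
  -- assemble: `Gap·μ(A)μ(Aᶜ) ≤ t·(2m)⁻¹·c_k·2μ_0(A)μ(Aᶜ)`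
  have hAc : 0 < ∑ u ∈ Aᶜ, μ k.succ u := by
    rcases (mul_pos_iff.mp hAk) with ⟨_, h⟩ | ⟨h1, _⟩
    · exact h
    · exact absurd h1 (not_lt.mpr (sum_nonneg fun u _ => (hμ _ u).le))
  have hA : 0 < ∑ u ∈ A, μ k.succ u := by
    rcases (mul_pos_iff.mp hAk) with ⟨h, _⟩ | ⟨_, h2⟩
    · exact h
    · exact absurd h2 (not_lt.mpr (sum_nonneg fun u _ => (hμ _ u).le))
  rw [le_div_iff₀ (by positivity)]
  have hstep : spectralGap (tensorFun μ) (fun y z : Fin (K + 1) → S => t * ptGraphSwap μ e φ y z + (1 - t) * prodKernel w M y z)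
      * ((∑ u ∈ A, μ k.succ u) * ∑ u ∈ Aᶜ, μ k.succ u)
      ≤ t * (1 / (2 * m) * (((univ.filter (fun r : Fin m => κ r = k)).card : ℝ) * (2 * ((∑ u ∈ A, μ 0 u) * ∑ u ∈ Aᶜ, μ k.succ u)))) := by
    refine hray.trans ?_
    exact mul_le_mul_of_nonneg_left (hsw.trans (mul_le_mul_of_nonneg_left hsum (by positivity))) ht0
  -- divide by `μ(Aᶜ) > 0`
  have e1 : spectralGap (tensorFun μ) (fun y z : Fin (K + 1) → S => t * ptGraphSwap μ e φ y z + (1 - t) * prodKernel w M y z)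
      * (m * ∑ u ∈ A, μ k.succ u)
      = (spectralGap (tensorFun μ) (fun y z : Fin (K + 1) → S => t * ptGraphSwap μ e φ y z + (1 - t) * prodKernel w M y z)
          * ((∑ u ∈ A, μ k.succ u) * ∑ u ∈ Aᶜ, μ k.succ u)) * (m / ∑ u ∈ Aᶜ, μ k.succ u) := by
    field_simp
  have e2 : t * ((univ.filter (fun r : Fin m => κ r = k)).card : ℝ) * (∑ u ∈ A, μ 0 u)
      = t * (1 / (2 * m) * (((univ.filter (fun r : Fin m => κ r = k)).card : ℝ) * (2 * ((∑ u ∈ A, μ 0 u) * ∑ u ∈ Aᶜ, μ k.succ u))))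
          * (m / ∑ u ∈ Aᶜ, μ k.succ u) := by
    field_simp
  rw [e1, e2]
  exact mul_le_mul_of_nonneg_right hstep (by positivity)

/-! ## §3 At a tight sector: the least-listed level, linear in the quality -/

/-- **`Gap ≤ t·c_k·p'/m` FOR EVERY COLD LEVEL AT A TIGHT SECTOR** (`μ_j(A) = θ ∈ (0,1)` for `j ≠ 0`, `μ_0(A) ≤ p'θ`; hypotheses of §2). [ours] -/
theorem tightSector_spectralGap_le_level [Nontrivial S] (hm : 1 ≤ m) (hμ : ∀ k x, 0 < μ k x) (hμ1 : ∀ k, ∑ u, μ k u = 1)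
    (hM : ∀ k, IsRowStochastic (M k)) (hMrev : ∀ k, DetailedBalance (μ k) (M k)) (hw0 : ∀ k, 0 ≤ w k) (hw1 : ∑ k, w k = 1)
    (ht0 : 0 ≤ t) (ht1 : t ≤ 1) {A : Finset S} (hφA : ∀ r u, φ r u ∈ A ↔ u ∈ A) {θ p' : ℝ} (hθ0 : 0 < θ) (hθ1 : θ < 1)
    (hcold : ∀ j : Fin (K + 1), j ≠ 0 → ∑ u ∈ A, μ j u = θ) (hhot : ∑ u ∈ A, μ 0 u ≤ p' * θ) (k : Fin K)
    (hidle : w k.succ * edgeMeasure (μ k.succ) (M k.succ) A Aᶜ = 0) :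
    spectralGap (tensorFun μ) (fun y z : Fin (K + 1) → S =>
        t * ptGraphSwap μ (fun r : Fin m => (((0 : Fin (K + 1)), (κ r).succ) : Fin (K + 1) × Fin (K + 1))) φ y z
          + (1 - t) * prodKernel w M y z)
      ≤ t * ((univ.filter (fun r : Fin m => κ r = k)).card : ℝ) * p' / m := by
  have hmpos : (0 : ℝ) < m := Nat.cast_pos.mpr (by omega)
  have h1θ : 0 < 1 - θ := by linarith
  have hAk : 0 < (∑ u ∈ A, μ k.succ u) * ∑ u ∈ Aᶜ, μ k.succ u := by
    rw [tightSector_coldBalance_eq hμ1 hcold k.succ (Fin.succ_ne_zero k)]; exact mul_pos hθ0 h1θ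
  have h := sectorOffer_spectralGap_le κ φ hm hμ hμ1 hM hMrev hw0 hw1 ht0 ht1 hφA k hAk hidle
  rw [hcold k.succ (Fin.succ_ne_zero k)] at h
  refine h.trans ?_
  rw [div_le_div_iff₀ (by positivity) hmpos]
  have hc0 : 0 ≤ t * ((univ.filter (fun r : Fin m => κ r = k)).card : ℝ) := by positivity
  calc t * ((univ.filter (fun r : Fin m => κ r = k)).card : ℝ) * (∑ u ∈ A, μ 0 u) * m
      ≤ t * ((univ.filter (fun r : Fin m => κ r = k)).card : ℝ) * (p' * θ) * m :=
        mul_le_mul_of_nonneg_right (mul_le_mul_of_nonneg_left hhot hc0) hmpos.le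
    _ = t * ((univ.filter (fun r : Fin m => κ r = k)).card : ℝ) * p' * (m * θ) := by ring

/-- **THE TWO-SIDED SWAP LAW PER LEVEL, LINEAR IN THE QUALITY:** exact hot redraws, one-sided domination `p ∈ (0,1]`, multiplicities `≥ c ≥ 1`,
`0 < t < 1`, `w_0 > 0`, tight sector, level `k+1` sector-idle: **`p·min{ct/(3m), (1−t)w_0/(7K)} ≤ Gap ≤ p'·c_k·t/m`**. [ours] -/
theorem tightSector_spectralGap_two_sided_level [Nontrivial S] (hK : 1 ≤ K) (hm : 1 ≤ m) (ht0 : 0 < t) (ht1 : t < 1)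
    (hw0 : ∀ k, 0 ≤ w k) (hw00 : 0 < w 0) (hw1 : ∑ k, w k = 1) (hμ : ∀ k x, 0 < μ k x)
    (hμ1 : ∀ k, ∑ u, μ k u = 1) (hM : ∀ k, IsRowStochastic (M k)) (hMrev : ∀ k, DetailedBalance (μ k) (M k))
    (hM0 : ∀ u v, M 0 u v = μ 0 v) (hp0 : 0 < p) (hp1 : p ≤ 1) (hdom : ∀ r u, p * μ (κ r).succ (φ r u) ≤ μ 0 u)
    {c : ℕ} (hc1 : 1 ≤ c) (hc : ∀ p' : Fin K, c ≤ (univ.filter (fun r : Fin m => κ r = p')).card)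
    {A : Finset S} (hφA : ∀ r u, φ r u ∈ A ↔ u ∈ A) {θ p' : ℝ} (hθ0 : 0 < θ) (hθ1 : θ < 1)
    (hcold : ∀ j : Fin (K + 1), j ≠ 0 → ∑ u ∈ A, μ j u = θ) (hhot : ∑ u ∈ A, μ 0 u ≤ p' * θ) (k : Fin K)
    (hidle : w k.succ * edgeMeasure (μ k.succ) (M k.succ) A Aᶜ = 0) :
    p * min (c * t / (3 * m)) ((1 - t) * w 0 / (7 * K))
        ≤ spectralGap (tensorFun μ) (fun y z : Fin (K + 1) → S =>
            t * ptGraphSwap μ (fun r : Fin m => (((0 : Fin (K + 1)), (κ r).succ) : Fin (K + 1) × Fin (K + 1))) φ y z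
              + (1 - t) * prodKernel w M y z)
      ∧ spectralGap (tensorFun μ) (fun y z : Fin (K + 1) → S =>
            t * ptGraphSwap μ (fun r : Fin m => (((0 : Fin (K + 1)), (κ r).succ) : Fin (K + 1) × Fin (K + 1))) φ y z
              + (1 - t) * prodKernel w M y z)
        ≤ p' * ((univ.filter (fun r : Fin m => κ r = k)).card : ℝ) * t / m := by
  refine ⟨dominatedStar_spectralGap_ge_regimeFree κ φ hK hm ht0 ht1 hw0 hw00 hw1 hμ hμ1 hM hMrev hM0 hp0 hp1 hdom hc1 hc, ?_⟩
  have h := tightSector_spectralGap_le_level κ φ hm hμ hμ1 hM hMrev hw0 hw1 ht0.le ht1.le hφA hθ0 hθ1 hcold hhot k hidle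
  calc _ ≤ t * ((univ.filter (fun r : Fin m => κ r = k)).card : ℝ) * p' / m := h
    _ = p' * ((univ.filter (fun r : Fin m => κ r = k)).card : ℝ) * t / m := by ring

/-! ## §4 The cold-start floor per level -/

/-- **`t_mix(ε) ≥ (m/(t·c_k·p') − 1)·log(1/(2ε))`** for every sector-idle cold level `k+1` at a tight sector (exact hot redraws, one-sided domination,
multiplicities `≥ c ≥ 1`, `0 < t < 1`, `w_0 > 0`, `t·c_k·p' < m`, `0 < ε ≤ ½`; the chain converges, so no closeness hypothesis). [ours] -/
theorem tightSector_mixingTime_ge_level [Nontrivial S] (hK : 1 ≤ K) (hm : 1 ≤ m) (ht0 : 0 < t) (ht1 : t < 1)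
    (hw0 : ∀ k, 0 ≤ w k) (hw00 : 0 < w 0) (hw1 : ∑ k, w k = 1) (hμ : ∀ k x, 0 < μ k x)
    (hμ1 : ∀ k, ∑ u, μ k u = 1) (hM : ∀ k, IsRowStochastic (M k)) (hMrev : ∀ k, DetailedBalance (μ k) (M k))
    (hM0 : ∀ u v, M 0 u v = μ 0 v) (hp0 : 0 < p) (hp1 : p ≤ 1) (hdom : ∀ r u, p * μ (κ r).succ (φ r u) ≤ μ 0 u)
    {c : ℕ} (hc1 : 1 ≤ c) (hc : ∀ p' : Fin K, c ≤ (univ.filter (fun r : Fin m => κ r = p')).card)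
    {A : Finset S} (hφA : ∀ r u, φ r u ∈ A ↔ u ∈ A) {θ p' : ℝ} (hθ0 : 0 < θ) (hθ1 : θ < 1)
    (hcold : ∀ j : Fin (K + 1), j ≠ 0 → ∑ u ∈ A, μ j u = θ) (hhot : ∑ u ∈ A, μ 0 u ≤ p' * θ) (k : Fin K)
    (hidle : w k.succ * edgeMeasure (μ k.succ) (M k.succ) A Aᶜ = 0)
    (hsmall : t * ((univ.filter (fun r : Fin m => κ r = k)).card : ℝ) * p' < m) {ε : ℝ} (hε : 0 < ε) (hε2 : ε ≤ 1 / 2) :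
    (m / (t * ((univ.filter (fun r : Fin m => κ r = k)).card : ℝ) * p') - 1) * Real.log (1 / (2 * ε))
      ≤ (mixingTime (fun y z : Fin (K + 1) → S =>
            t * ptGraphSwap μ (fun r : Fin m => (((0 : Fin (K + 1)), (κ r).succ) : Fin (K + 1) × Fin (K + 1))) φ y z
              + (1 - t) * prodKernel w M y z) (tensorFun μ) ε : ℝ) := by
  have hmpos : (0 : ℝ) < m := Nat.cast_pos.mpr (by omega)
  set e : Fin m → Fin (K + 1) × Fin (K + 1) := fun r => (((0 : Fin (K + 1)), (κ r).succ) : Fin (K + 1) × Fin (K + 1))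
    with he_def
  have hP := weightedScheme_isRowStochastic (t := t) (w := w) (ptGraphSwap_isRowStochastic (e := e) (φ := φ) hμ) hM
    hw0 hw1 ht0.le ht1.le
  have hDB := weightedScheme_detailedBalance (w := w) (ptGraphSwap_detailedBalance (e := e) (φ := φ) hμ) hMrev t
  have hirr := dominatedStar_isIrreducible_regimeFree κ φ ht0 ht1 hw0 hw00 hw1 hμ hM hM0 hc1 hc
  have hgap := tightSector_spectralGap_le_level κ φ hm hμ hμ1 hM hMrev hw0 hw1 ht0.le ht1.le hφA hθ0 hθ1 hcold hhot k hidle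
  -- the chain is `ε`-close at some time: chapter N's `ℓ²` ceiling at `π̃_min = min_x π̃(x)`
  obtain ⟨x₀, -, hx₀⟩ := Finset.exists_min_image (univ : Finset (Fin (K + 1) → S)) (tensorFun μ) univ_nonempty
  have hmix : ∃ n : ℕ, worstTvDist (fun y z : Fin (K + 1) → S => t * ptGraphSwap μ e φ y z + (1 - t) * prodKernel w M y z)
      (tensorFun μ) n ≤ ε :=
    ⟨_, dominatedStar_worstTvDist_le_regimeFree κ φ hK hm ht0 ht1 hw0 hw00 hw1 hμ hμ1 hM hMrev hM0 hp0 hp1 hdom hc1 hc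
      (tensorFun_pos hμ x₀) (fun x => hx₀ x (mem_univ x)) hε (Nat.le_ceil _)⟩
  have hu : t * ((univ.filter (fun r : Fin m => κ r = k)).card : ℝ) * p' / m < 1 := by
    rw [div_lt_one hmpos]; exact hsmall
  rw [show (m : ℝ) / (t * ((univ.filter (fun r : Fin m => κ r = k)).card : ℝ) * p') - 1
      = 1 / (t * ((univ.filter (fun r : Fin m => κ r = k)).card : ℝ) * p' / m) - 1 by rw [one_div_div]]
  exact mixingTime_ge_of_spectralGap_le (tensorFun_pos hμ) (sum_tensorFun_eq_one μ hμ1) hP hDB hirr hgap hu hε hε2 hmix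

end Star

end Summit.Ventures.LatticeQCDFlow.Scaling

end
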